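import Literature.NumberTheory.Automorphic.RankinSelbergIntegralEntire
import HarnessLib

/-!
# The continued Rankin–Selberg numerator at `s = 0`: `F(0) = V Φ(0) / n · ∫ φ φ'`

Topic `NumberTheory/Automorphic`; namespace `Literature.NumberTheory.Automorphic`. Proof file (theorems
only: no definition, no named fact, no instance). Complement to `RankinSelbergIntegralEntire`: there the
global Rankin–Selberg integral is continued to the whole plane — an entire `F` with
`F(s) = s (s - 1) I(s; φ, φ', Φ)` for `re s > 1`, namely `F(s) = ∫ φ φ' E*_X(s, ·) dμ'` with the Tate
numerator `E*` of the mirabolic Eisenstein series (`tateNumerator`, `tateNumeratorGL`,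
`tateNumeratorQuot`). Here the value of this continuation at `s = 0` is computed: in Tate's form
`E*(s, g) = |det g|^s [s (s - 1)(T₁(s) + c_D T₂(s)) + c_D V Φ̂(0) s / n - V Φ(0 · g)(s - 1)/n]` only the
last term survives at `s = 0`, and `Φ(0 · g) = Φ(0)`: **`E*(0, g) = V Φ(0) / n` for every `g`**
(`tateNumerator_zero`, `tateNumeratorGL_zero`, `tateNumeratorQuot_zero`; `V = idelicCovolume K ν`) — the
`g`-independence of the residue of `E(g, Φ; s)` at `s = 0` (Jacquet–Shalika (1981), §4, Lemma 4.2;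
Cogdell (2004), §2.3, p. 211: the residue at `s = 0` is `-V Φ(0)/n`, a constant). Consequently
(`exists_entire_eq_mul_rankinSelbergIntegral_apply_zero`, the theorem of `RankinSelbergIntegralEntire`
with its proof, verbatim, and one more conclusion) the entire continuation satisfies
**`F(0) = V Φ(0) / n · ∫ φ φ' dμ'`** — so `F(0) = 0` as soon as `∫ φ φ' = 0`, e.g. for cusp forms in
inequivalent representations (`integral_mul_eq_zero_of_ne_conj`): the vanishing of the residue of
`I(s; φ, φ', Φ)` at `s = 0` for `π ≇ π̃'` WITHOUT the functional equation, the input `h0` of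
`MoeglinWaldspurger1989_partialPairL_entire_of_ne_conj_of_local`
(`PairLFunctionMeromorphicContinuationNeConjLocalReduction`).

## References

* H. Jacquet, J. A. Shalika, *On Euler products and the classification of automorphic representations
  I*, Amer. J. Math. 103 (1981), §4, Lemma 4.2 and (4.6) [JacquetShalikaAJM1981].
* J. W. Cogdell, *Analytic theory of L-functions for GL_n*, in *An Introduction to the Langlands
  Program* (2004), §2.3, pp. 210–211 and Thm. 2.2 [CogdellAnalyticTheory2004].
-/

noncomputable section

open scoped NNReal ENNReal Topology Classical MatrixGroups Pointwise
open NumberField NumberField.mixedEmbedding IsDedekindDomain MeasureTheory Measure Matrix Filter Set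

namespace Literature.NumberTheory.Automorphic

variable {K : Type} [Field K] [NumberField K] {n : ℕ}
variable [MeasurableSpace (AdeleRing (𝓞 K) K)] [BorelSpace (AdeleRing (𝓞 K) K)]

-- verbatim from `RankinSelbergIntegralEntire`
attribute [local instance] borelSpace_ideleGroup

variable (ν : Measure (GaloisRepresentations.ideleGroup K))

/-! ### The numerator at `s = 0` -/

section Zero

variable (μ : Measure (Fin n → AdeleRing (𝓞 K) K))

/-- **`tateNumerator ν μ 𝓕 Ψ 0 = V Ψ(0) / n`**: at `s = 0` only the boundary term `-V Ψ(0) (s - 1)/n`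
survives. [cite: CogdellAnalyticTheory2004, §2.3, p. 211] -/
theorem tateNumerator_zero (𝓕 : Set (GaloisRepresentations.ideleGroup K)) (Ψ : (Fin n → AdeleRing (𝓞 K) K) → ℂ) :
    tateNumerator ν μ 𝓕 Ψ 0 = ((idelicCovolume K ν).toReal : ℂ) * Ψ 0 / n := by
  unfold tateNumerator
  ring

/-- **`E*(0, g) = V Φ(0) / n` for every `g`** (`|det g|^0 = 1`, `Φ(0 · g) = Φ(0)`): the residue of the
mirabolic Eisenstein series at `s = 0` does not depend on `g`. [cite: JacquetShalikaAJM1981, §4, Lemma 4.2] -/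
theorem tateNumeratorGL_zero (𝓕 : Set (GaloisRepresentations.ideleGroup K)) (Φ : (Fin n → AdeleRing (𝓞 K) K) → ℂ)
    (g : GL (Fin n) (AdeleRing (𝓞 K) K)) :
    tateNumeratorGL ν μ 𝓕 Φ 0 g = ((idelicCovolume K ν).toReal : ℂ) * Φ 0 / n := by
  unfold tateNumeratorGL
  rw [tateNumerator_zero, Complex.cpow_zero, one_mul, Matrix.zero_vecMul]

/-- **`E*_X(0, x) = V Φ(0) / n` for every `x`.** [cite: JacquetShalikaAJM1981, §4, Lemma 4.2] -/
theorem tateNumeratorQuot_zero (𝓕 : Set (GaloisRepresentations.ideleGroup K)) (Φ : (Fin n → AdeleRing (𝓞 K) K) → ℂ)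
    (x : (AdelicGroupData.gl n K).automorphicQuotient) :
    tateNumeratorQuot ν μ 𝓕 Φ 0 x = ((idelicCovolume K ν).toReal : ℂ) * Φ 0 / n :=
  tateNumeratorGL_zero ν μ 𝓕 Φ _

end Zero

/-! ### The entire continuation and its value at `s = 0` -/

section Main

variable [ν.IsHaarMeasure]

/-- **`s (s - 1) I(s; φ, φ', Φ)` extends to an entire function `F` with `F(0) = V Φ(0)/n · ∫ φ φ'`.**
The theorem `exists_entire_eq_mul_rankinSelbergIntegral` of `RankinSelbergIntegralEntire` — for an
automorphic measure `μ'` on `GL_n(𝔸_K) ⧸ A_G GL_n(K)` (`n ≥ 1`), a Haar measure `ν` on `𝔸_Kˣ`,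
`Φ ∈ piSchwartzBruhat K (Fin n)` and continuous `φ`, `φ'` with rapidly decreasing classical functions there
is an entire `F` with `F(s) = s (s - 1) · rankinSelbergIntegral μ' ν Φ s φ φ'` for `re s > 1` — with the
same proof (verbatim: `F(s) = ∫ φ φ' E*_X(s, ·) dμ'`, a holomorphic dominated parameter integral) and one
more conclusion read off from `tateNumeratorQuot_zero`: `F(0) = V Φ(0) / n · ∫ φ φ' dμ'` (Cogdell (2004),
§2.3, p. 211 and Thm. 2.2: the possible pole at `s = 0` is simple with residue proportional to
`Φ(0) ∫ φ φ'`). [cite: CogdellAnalyticTheory2004, §2.3, p. 211 and Thm. 2.2] [cite: JacquetShalikaAJM1981, §4, (4.6)] -/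
theorem exists_entire_eq_mul_rankinSelbergIntegral_apply_zero [ν.IsMulRightInvariant] (hn : 0 < n)
    (μ' : Measure (AdelicGroupData.gl n K).automorphicQuotient)
    [(AdelicGroupData.gl n K).IsAutomorphicMeasure μ']
    {Φ : (Fin n → AdeleRing (𝓞 K) K) → ℂ} (hΦ : Φ ∈ piSchwartzBruhat K (Fin n))
    {φ φ' : (AdelicGroupData.gl n K).automorphicQuotient → ℂ} (hφc : Continuous φ) (hφ'c : Continuous φ')
    (hφd : IsRapidlyDecreasingGL n K (invQuot (AdelicGroupData.gl n K) φ))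
    (hφ'd : IsRapidlyDecreasingGL n K (invQuot (AdelicGroupData.gl n K) φ')) :
    ∃ F : ℂ → ℂ, Differentiable ℂ F ∧
      (∀ s : ℂ, 1 < s.re → F s = s * (s - 1) * rankinSelbergIntegral μ' ν Φ s φ φ') ∧
      F 0 = ((idelicCovolume K ν).toReal : ℂ) * Φ 0 / n * ∫ x, φ x * φ' x ∂μ' := by
  -- the group, its Borel structure, a Haar measure and the Siegel domination of `μ'`
  letI : MeasurableSpace (GL (Fin n) (AdeleRing (𝓞 K) K)) := borel _
  haveI : BorelSpace (GL (Fin n) (AdeleRing (𝓞 K) K)) := ⟨rfl⟩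
  haveI : T2Space (GL (Fin n) (AdeleRing (𝓞 K) K)) := t2Space_gl n K
  haveI : LocallyCompactSpace (GL (Fin n) (AdeleRing (𝓞 K) K)) :=
    AdelicGroupData.locallyCompactSpace_generalLinearGroup_adeleRing K (Fin n)
  haveI := secondCountableTopology_ideleGroup K
  haveI := locallyCompactSpace_ideleGroup K
  haveI := secondCountableTopology_adeleRing K
  haveI := locallyCompactSpace_adeleRing' K
  obtain ⟨𝓕, h𝓕⟩ := exists_isIdeleClassDomain K
  set μ : Measure (Fin n → AdeleRing (𝓞 K) K) := Measure.addHaar with hμ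
  set μG : Measure (GL (Fin n) (AdeleRing (𝓞 K) K)) := haar with hμG
  obtain ⟨c, Ω, t, Z, hc, ht, hΩc, hΩB, hZc, hZ, hle⟩ :=
    exists_lintegral_le_mul_setLIntegral_siegel n K μ' μG
  set S : Set (GL (Fin n) (AdeleRing (𝓞 K) K)) := Z * (Ω * siegelCone n K t *
    (standardMaximalCompactGL n K : Set (GL (Fin n) (AdeleRing (𝓞 K) K)))) with hS
  have hSm : MeasurableSet S := measurableSet_mul_siegelSet n K hZc hΩc ht
  -- notation
  set cD : ℝ := (μ (piFundamentalDomain K (Fin n))).toReal⁻¹ with hcD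
  set Vr : ℝ := (idelicCovolume K ν).toReal with hVr
  set P : (AdelicGroupData.gl n K).automorphicQuotient → ℂ := fun x => φ x * φ' x with hP
  set ψ : GL (Fin n) (AdeleRing (𝓞 K) K) → ℂ := invQuot (AdelicGroupData.gl n K) φ with hψ
  set ψ' : GL (Fin n) (AdeleRing (𝓞 K) K) → ℂ := invQuot (AdelicGroupData.gl n K) φ' with hψ'
  set E : ℂ → (AdelicGroupData.gl n K).automorphicQuotient → ℂ := fun s x => tateNumeratorQuot ν μ 𝓕 Φ s x
    with hEdef
  have hmk' : Continuous fun g : GL (Fin n) (AdeleRing (𝓞 K) K) =>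
      (AdelicGroupData.gl n K).toAutomorphicQuotient g :=
    (AdelicGroupData.gl n K).continuous_toAutomorphicQuotient
  have hinv : Continuous fun g : GL (Fin n) (AdeleRing (𝓞 K) K) => (g⁻¹ : GL (Fin n) (AdeleRing (𝓞 K) K)) :=
    continuous_inv
  have hmkc : Continuous fun g : GL (Fin n) (AdeleRing (𝓞 K) K) =>
      (AdelicGroupData.gl n K).toAutomorphicQuotient g⁻¹ :=
    hmk'.comp hinv
  have hψc : Continuous ψ := hφc.comp hmkc
  have hψ'c : Continuous ψ' := hφ'c.comp hmkc
  have hPmk : ∀ g : GL (Fin n) (AdeleRing (𝓞 K) K),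
      P ((AdelicGroupData.gl n K).toAutomorphicQuotient g⁻¹) = ψ g * ψ' g := fun g => rfl
  have hEg : ∀ (s : ℂ) (g : GL (Fin n) (AdeleRing (𝓞 K) K)),
      E s ((AdelicGroupData.gl n K).toAutomorphicQuotient g⁻¹) = tateNumeratorGL ν μ 𝓕 Φ s g := by
    intro s g
    show tateNumeratorQuot ν μ 𝓕 Φ s
      ((AdelicGroupData.gl n K).toAutomorphicQuotient (g⁻¹ : GL (Fin n) (AdeleRing (𝓞 K) K))) = _
    rw [tateNumeratorQuot_toAutomorphicQuotient ν μ hn h𝓕 hΦ s (g⁻¹ : GL (Fin n) (AdeleRing (𝓞 K) K)), inv_inv]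
  -- (1) the decomposition `g = a · y` on `S` and the bounds for `|det g|`
  obtain ⟨CΩ, hCΩc, hdec⟩ := exists_siegel_decomposition hΩc hΩB ht hZ
  set Y : Set (GL (Fin n) (AdeleRing (𝓞 K) K)) := Z * CΩ *
    (standardMaximalCompactGL n K : Set (GL (Fin n) (AdeleRing (𝓞 K) K))) with hY
  have hYc : IsCompact Y := (hZc.mul hCΩc).mul (isCompact_standardMaximalCompactGL n K)
  have hNc : Continuous fun g : GL (Fin n) (AdeleRing (𝓞 K) K) =>
      (IdeleClassGroup.ideleNorm K (Matrix.GeneralLinearGroup.det g) : ℝ) :=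
    NNReal.continuous_coe.comp ((continuous_ideleNorm_holds K).comp Matrix.GeneralLinearGroup.continuous_det)
  have hNpos : ∀ g : GL (Fin n) (AdeleRing (𝓞 K) K),
      0 < (IdeleClassGroup.ideleNorm K (Matrix.GeneralLinearGroup.det g) : ℝ) := fun g => ideleNorm_real_pos _
  obtain ⟨D, hD⟩ := hYc.exists_bound_of_continuousOn hNc.continuousOn
  obtain ⟨A₀, hA₀⟩ := hYc.exists_bound_of_continuousOn
    ((hNc.inv₀ fun g => (hNpos g).ne').continuousOn)
  set D₂ : ℝ := max D 1 with hD₂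
  set A : ℝ := max A₀ 1 with hA
  have hD₂1 : 1 ≤ D₂ := le_max_right _ _
  have hA1 : 1 ≤ A := le_max_right _ _
  have hdetS : ∀ g ∈ S,
      (IdeleClassGroup.ideleNorm K (Matrix.GeneralLinearGroup.det g) : ℝ) ≤ D₂ ∧
      ((adelicAbsDet n K g⁻¹ : ℝ≥0) : ℝ) ≤ A := by
    intro g hg
    obtain ⟨b, hprod, hroot, y, hyY, rfl⟩ := hdec g hg
    have hdet : (IdeleClassGroup.ideleNorm K
        (Matrix.GeneralLinearGroup.det (posRealDiagonal n K b * y)) : ℝ) =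
        (IdeleClassGroup.ideleNorm K (Matrix.GeneralLinearGroup.det y) : ℝ) := by
      change ((glAbsDet n K (posRealDiagonal n K b * y) : ℝ≥0) : ℝ) = ((glAbsDet n K y : ℝ≥0) : ℝ)
      rw [map_mul, glAbsDet_eq_one_of_mem_siegelCone ⟨b, hprod, hroot, rfl⟩, one_mul]
    have hdet' : ((adelicAbsDet n K (posRealDiagonal n K b * y)⁻¹ : ℝ≥0) : ℝ) =
        (IdeleClassGroup.ideleNorm K (Matrix.GeneralLinearGroup.det y) : ℝ)⁻¹ := by
      rw [map_inv, NNReal.coe_inv, ← hdet]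
      rfl
    refine ⟨?_, ?_⟩
    · rw [hdet]
      exact ((Real.le_norm_self _).trans (hD y hyY)).trans (le_max_left _ _)
    · rw [hdet']
      exact ((Real.le_norm_self _).trans (hA₀ y hyY)).trans (le_max_left _ _)
  -- the entire function
  refine ⟨fun s => ∫ x, P x * E s x ∂μ', ?_, ?_, ?_⟩
  rotate_left
  · -- agreement with `s (s - 1) I(s)` on `re s > 1`
    intro s hs
    change ∫ x, P x * E s x ∂μ' = s * (s - 1) * ∫ x, φ x * φ' x * mirabolicEisensteinQuot ν Φ s x ∂μ'
    rw [← integral_const_mul]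
    refine integral_congr_ae (ae_of_all _ fun x => ?_)
    simp only [hEdef, hP]
    rw [tateNumeratorQuot_eq_mul ν μ hn h𝓕 hΦ hs]
    ring
  · -- the value at `s = 0`: `E*_X(0, ·) = V Φ(0) / n` is constant
    change ∫ x, P x * E 0 x ∂μ' = _
    simp only [hEdef, hP, tateNumeratorQuot_zero]
    rw [integral_mul_const, hVr]
    ring
  suffices hU : DifferentiableOn ℂ (fun s => ∫ x, P x * E s x ∂μ') univ from
    fun s => hU.differentiableAt (isOpen_univ.mem_nhds (mem_univ s))
  refine Literature.Analysis.Complex.differentiableOn_integral_of_dominated (μ := μ') ?_ ?_ ?_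
  · -- measurability of the integrand for every `s`
    intro s _
    exact ((hφc.mul hφ'c).mul (continuous_tateNumeratorQuot ν μ hn h𝓕 hΦ s)).aestronglyMeasurable
  · -- holomorphy of the integrand in `s`
    refine ae_of_all _ fun x => ?_
    exact ((differentiable_tateNumeratorQuot ν μ h𝓕 hΦ x).const_mul (P x)).differentiableOn
  · -- local domination near `s₀`
    intro s₀ _
    set R : ℝ := ‖s₀‖ + 1 with hR
    have hR0 : 0 ≤ R := by positivity
    have hball : ∀ s ∈ Metric.ball s₀ 1, ‖s‖ ≤ R := by
      intro s hs
      rw [Metric.mem_ball, dist_eq_norm] at hs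
      calc ‖s‖ = ‖(s - s₀) + s₀‖ := by rw [sub_add_cancel]
        _ ≤ ‖s - s₀‖ + ‖s₀‖ := norm_add_le _ _
        _ ≤ R := by rw [hR]; linarith
    -- (2) the dominating function `H` and `J = ∫_S |ψ ψ'| H < ∞`
    set σ : ℝ := R + 2 with hσ
    have hσ1 : 1 < σ := by rw [hσ]; linarith
    set M₁ : GL (Fin n) (AdeleRing (𝓞 K) K) → ℝ≥0∞ := fun g => ∑' p : Projectivization K (Fin n → K),
      ∫⁻ a, (‖Φ ((a : AdeleRing (𝓞 K) K) •
          (ratVec K p.rep ᵥ* (g : Matrix (Fin n) (Fin n) (AdeleRing (𝓞 K) K))))‖ₑ : ℝ≥0∞) *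
        ENNReal.ofReal ((IdeleClassGroup.ideleNorm K a : ℝ) ^ ((n : ℝ) * (R + 2))) ∂ν with hM₁
    set M₂ : GL (Fin n) (AdeleRing (𝓞 K) K) → ℝ≥0∞ := fun g => ∑' p : Projectivization K (Fin n → K),
      ∫⁻ a, (‖adelicPiFourier K (Fin n) μ Φ ((a : AdeleRing (𝓞 K) K) •
          (ratVec K p.rep ᵥ* ((glTransposeInv g : GL (Fin n) (AdeleRing (𝓞 K) K)) :
            Matrix (Fin n) (Fin n) (AdeleRing (𝓞 K) K))))‖ₑ : ℝ≥0∞) *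
        ENNReal.ofReal ((IdeleClassGroup.ideleNorm K a : ℝ) ^ ((n : ℝ) * (R + 2))) ∂ν with hM₂
    set c₁ : ℝ≥0∞ := ENNReal.ofReal ((D₂ * A) ^ R * (R + 1) ^ 2) with hc₁
    set c₂ : ℝ≥0∞ := ENNReal.ofReal (cD * A) with hc₂
    set c₃ : ℝ≥0∞ := ENNReal.ofReal ((cD * Vr * A * ‖∫ v, Φ v ∂μ‖ + Vr * ‖Φ 0‖) / n) with hc₃
    set H : GL (Fin n) (AdeleRing (𝓞 K) K) → ℝ≥0∞ := fun g => c₁ * (M₁ g + c₂ * M₂ g + c₃) with hH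
    have hHm : Measurable H := by
      have hM₁m : Measurable M₁ :=
        measurable_tsum_lintegral_enorm_smul_vecMul ν (continuous_of_mem_piSchwartzBruhat hΦ) _ continuous_id
      have hM₂m : Measurable M₂ :=
        measurable_tsum_lintegral_enorm_smul_vecMul ν
          (continuous_of_mem_piSchwartzBruhat (adelicPiFourier_mem_piSchwartzBruhat hΦ)) _
          continuous_glTransposeInv
      exact ((hM₁m.add (hM₂m.const_mul _)).add_const _).const_mul _
    have hPHm : Measurable fun g : GL (Fin n) (AdeleRing (𝓞 K) K) => (‖ψ g * ψ' g‖ₑ : ℝ≥0∞) * H g :=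
      ((hψc.mul hψ'c).measurable.enorm).mul hHm
    set J : ℝ≥0∞ := ∫⁻ g in S, (‖ψ g * ψ' g‖ₑ : ℝ≥0∞) * H g ∂μG with hJ
    have hJfin : J < ⊤ := by
      have hsq : ∀ a b : ℝ≥0∞, a * b ≤ a ^ 2 + b ^ 2 := fun a b => by
        rcases le_total a b with h | h
        · calc a * b ≤ b * b := mul_le_mul' h le_rfl
            _ = b ^ 2 := (sq b).symm
            _ ≤ a ^ 2 + b ^ 2 := le_add_self
        · calc a * b ≤ a * a := mul_le_mul' le_rfl h
            _ = a ^ 2 := (sq a).symm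
            _ ≤ a ^ 2 + b ^ 2 := le_self_add
      have hψm : Measurable fun g : GL (Fin n) (AdeleRing (𝓞 K) K) => (‖ψ g‖ₑ : ℝ≥0∞) ^ 2 * H g :=
        (hψc.measurable.enorm.pow_const 2).mul hHm
      have hfinψ := setLIntegral_siegel_normSq_mul_majorants_lt_top K ν μ μG hΦ hσ1 hψc hφd hΩc hΩB ht
        hZc hZ (c₁ := c₁) (c₂ := c₂) (c₃ := c₃) ENNReal.ofReal_ne_top ENNReal.ofReal_ne_top ENNReal.ofReal_ne_top
      have hfinψ' := setLIntegral_siegel_normSq_mul_majorants_lt_top K ν μ μG hΦ hσ1 hψ'c hφ'd hΩc hΩB ht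
        hZc hZ (c₁ := c₁) (c₂ := c₂) (c₃ := c₃) ENNReal.ofReal_ne_top ENNReal.ofReal_ne_top ENNReal.ofReal_ne_top
      calc J ≤ ∫⁻ g in S, (‖ψ g‖ₑ : ℝ≥0∞) ^ 2 * H g + (‖ψ' g‖ₑ : ℝ≥0∞) ^ 2 * H g ∂μG := by
            refine lintegral_mono fun g => ?_
            rw [← add_mul, enorm_mul]
            exact mul_le_mul' (hsq _ _) le_rfl
        _ = (∫⁻ g in S, (‖ψ g‖ₑ : ℝ≥0∞) ^ 2 * H g ∂μG) + ∫⁻ g in S, (‖ψ' g‖ₑ : ℝ≥0∞) ^ 2 * H g ∂μG :=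
            lintegral_add_left hψm _
        _ < ⊤ := ENNReal.add_lt_top.2 ⟨hfinψ, hfinψ'⟩
    -- pointwise bound on `S` for `s` in the ball
    have hpt : ∀ s ∈ Metric.ball s₀ 1, ∀ g ∈ S, (‖tateNumeratorGL ν μ 𝓕 Φ s g‖ₑ : ℝ≥0∞) ≤ H g := by
      intro s hs g hg
      obtain ⟨hgD, hgA⟩ := hdetS g hg
      exact enorm_tateNumeratorGL_le_of_norm_le ν μ h𝓕 hΦ hD₂1 hA1 hR0 hgD hgA (hball s hs)
    -- (3) a countable dense subset of the ball and the countable supremum `Hq`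
    obtain ⟨Dc, hDcsub, hDcc, hDcd⟩ :
        ∃ Dc : Set ℂ, Dc ⊆ Metric.ball s₀ 1 ∧ Dc.Countable ∧ Metric.ball s₀ 1 ⊆ closure Dc :=
      (TopologicalSpace.IsSeparable.of_separableSpace _).exists_countable_dense_subset
    haveI : Countable Dc := hDcc.to_subtype
    set Hq : (AdelicGroupData.gl n K).automorphicQuotient → ℝ≥0∞ := fun x =>
      ⨆ d : Dc, (‖E (d : ℂ) x‖ₑ : ℝ≥0∞) with hHq
    have hHqm : Measurable Hq := by
      refine Measurable.iSup fun d => ?_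
      exact (continuous_tateNumeratorQuot ν μ hn h𝓕 hΦ (d : ℂ)).measurable.enorm
    -- `E(s, x)` is dominated by `Hq x` for every `s` in the ball (continuity in `s`)
    have hEHq : ∀ (x : (AdelicGroupData.gl n K).automorphicQuotient) (s : ℂ), s ∈ Metric.ball s₀ 1 →
        (‖E s x‖ₑ : ℝ≥0∞) ≤ Hq x := by
      intro x s hs
      have hcont : ContinuousWithinAt (fun z : ℂ => E z x) (Metric.ball s₀ 1) s :=
        ((differentiable_tateNumeratorQuot ν μ h𝓕 hΦ x).continuous.continuousOn) s hs
      exact enorm_le_iSup_of_continuousWithinAt hDcsub hcont (hDcd hs)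
    -- on the Siegel set, `Hq(π g⁻¹) ≤ H g`
    have hHqS : ∀ g ∈ S, Hq ((AdelicGroupData.gl n K).toAutomorphicQuotient g⁻¹) ≤ H g := by
      intro g hg
      refine iSup_le fun d => ?_
      rw [hEg]
      exact hpt d.1 (hDcsub d.2) g hg
    -- the majorant `(‖P‖ Hq).toReal` is integrable
    have hPHqm : Measurable fun x => (‖P x‖ₑ : ℝ≥0∞) * Hq x := (hφc.mul hφ'c).measurable.enorm.mul hHqm
    have hlin : ∫⁻ x, (‖P x‖ₑ : ℝ≥0∞) * Hq x ∂μ' ≤ c * J := by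
      calc ∫⁻ x, (‖P x‖ₑ : ℝ≥0∞) * Hq x ∂μ'
          ≤ c * ∫⁻ g in S, (‖P ((AdelicGroupData.gl n K).toAutomorphicQuotient g⁻¹)‖ₑ : ℝ≥0∞) *
              Hq ((AdelicGroupData.gl n K).toAutomorphicQuotient g⁻¹) ∂μG := hle _
        _ ≤ c * J := by
            refine mul_le_mul' le_rfl (setLIntegral_mono' hSm fun g hg => ?_)
            rw [hPmk]
            exact mul_le_mul' le_rfl (hHqS g hg)
    have hfin : ∫⁻ x, (‖P x‖ₑ : ℝ≥0∞) * Hq x ∂μ' ≠ ⊤ :=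
      ne_of_lt (lt_of_le_of_lt hlin (ENNReal.mul_lt_top hc.lt_top hJfin))
    have hae : ∀ᵐ x ∂μ', (‖P x‖ₑ : ℝ≥0∞) * Hq x < ⊤ := ae_lt_top hPHqm hfin
    refine ⟨1, one_pos, subset_univ _, fun x => ((‖P x‖ₑ : ℝ≥0∞) * Hq x).toReal,
      integrable_toReal_of_lintegral_ne_top hPHqm.aemeasurable hfin, ?_⟩
    filter_upwards [hae] with x hx s hs
    have hle' : (‖P x * E s x‖ₑ : ℝ≥0∞) ≤ (‖P x‖ₑ : ℝ≥0∞) * Hq x := by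
      rw [enorm_mul]
      exact mul_le_mul' le_rfl (hEHq x s hs)
    calc ‖P x * E s x‖
        = ((‖P x * E s x‖ₑ : ℝ≥0∞)).toReal := (toReal_enorm _).symm
      _ ≤ ((‖P x‖ₑ : ℝ≥0∞) * Hq x).toReal := ENNReal.toReal_mono hx.ne hle'


end Main

end Literature.NumberTheory.Automorphic
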